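import Summits.NavierStokesRegularity.NavierStokesRegularity.Theses.QuantisedSymmetry
import Summits.NavierStokesRegularity.NavierStokesRegularity.Theses.Blowup
import Summits.NavierStokesRegularity.NavierStokesRegularity.Theses.DssFarFieldSlaving
import Summits.NavierStokesRegularity.NavierStokesRegularity.Theorems.QuantisedSymmetryPolyhedralDssProfileExistsDominatesBlowupProfile
import Summits.NavierStokesRegularity.NavierStokesRegularity.Theorems.DssFarFieldSlavingDssTruncationBridge
import Summits.NavierStokesRegularity.NavierStokesRegularity.Theorems.QuantisedSymmetryPolyhedralTruncationBridge
import Summits.NavierStokesRegularity.NavierStokesRegularity.Theorems.QuantisedSymmetryLiouvilleKillsProfile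
import Summits.NavierStokesRegularity.NavierStokesRegularity.Theorems.DssFarFieldSlavingBlowupTypeIDssProfileControlsClassLevel
import Literature.Analysis.FluidPDE.TypeIAncientMild
import Literature.Analysis.FluidPDE.NSBoundedMildOseen
import Literature.Analysis.FluidPDE.BradshawTsaiDSSExistenceHolds
import Literature.Analysis.FluidPDE.ChaeWolfDSSDecayLtNine
import HarnessLib

/-!
# Strategist sketch s19-g9 (independent census family `s`, gen 9) for the crux
`QuantisedSymmetry.PolyhedralDssProfileExists` (stmt-NavierStokesRegularity-1404)

Companion file of `STRATEGY-CENSUS-s19.md`.  It records, as CHECKED Lean statements, the concrete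
attempts of the census — nothing here is a registered line and nothing carries a `sorry`:

* §W  the strictly-weaker-intermediate analysis: the crux factors through the G-BLIND item
  `Blowup.BlowupTypeIDssProfile` (stmt-0155, wanted by route `DssFarFieldSlaving`, OPEN), which already
  decides the summit in tree (`W₁_decides`); the only other typed weakening, `¬ PolyhedralTypeILiouville`,
  is implied by the crux (`crux_implies_W₂`) but has no bridge to `¬ NavierStokesRegularity`.
* §D  the best typed split: uniform approximate `G`-cells (`UniformApproxCells`, carries all the
  existence content) + parabolic compactness (`ApproxCellCompactness`, provable), assembly
  `crux_of_split` (modus ponens).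
* §S  the strengthenings: the self-similar one is REFUTED in tree (`not_selfSimilarPolyhedralProfileExists`,
  from `ControlsClassLevel.typeI_ancient_selfSimilar_ae_zero` = Tsai 1998 / NRŠ 1996 at class level) although
  it would imply the crux (`selfSimilar_strengthening_implies_crux`).
* §T  the sibling theorems the transfer attempts start from, cited BY NAME so the names are checked.
-/

set_option linter.dupNamespace false
set_option linter.unusedVariables false

noncomputable section

namespace Summit.NavierStokesRegularity.NavierStokesRegularity.Cruxes.PolyhedralDssProfileExists.StrategistS19g9

open MeasureTheory Literature.Analysis.FluidPDE
open Summit.NavierStokesRegularity.NavierStokesRegularity.Theses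

/-- Shorthand for physical space. -/
abbrev E3 : Type := EuclideanSpace ℝ (Fin 3)

/-- The polyhedral-group predicate of the crux: finite, proper rotations, irreducible on `ℝ³`
(T/O/I up to conjugacy). -/
def IsPolyhedral (G : Subgroup (E3 ≃ₗᵢ[ℝ] E3)) : Prop :=
  Finite G ∧ (∀ g ∈ G, LinearMap.det (g.toLinearEquiv : E3 →ₗ[ℝ] E3) = 1) ∧
    (∀ V : Submodule ℝ E3, (∀ g ∈ G, ∀ v ∈ V, g v ∈ V) → V = ⊥ ∨ V = ⊤)

/-! ## §W — strictly weaker intermediates between the crux and the summit -/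

/-- **W₁ dominates**: the crux implies the G-blind item `Blowup.BlowupTypeIDssProfile` (stmt-0155;
landed as `stub_dominatesBlowupProfile`, line `polyhedral_cell`). -/
theorem crux_implies_W₁ :
    QuantisedSymmetry.PolyhedralDssProfileExists → Blowup.BlowupTypeIDssProfile :=
  Theorems.PolyhedralDssProfileExists.PolyhedralCell.stub_dominatesBlowupProfile

/-- **W₁ already decides the summit in tree**: route `DssFarFieldSlaving`'s deciding theorem with its
bridge `DssTruncationBridge` PROVED (`dssTruncationBridge_proof`, an instance of the G-blind
`filamentSkeletonRss_rdssProfileTruncation_proof`) and Clay-class uniqueness proved. -/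
theorem W₁_decides : Blowup.BlowupTypeIDssProfile → ¬ _root_.NavierStokesRegularity :=
  fun hW => DssFarFieldSlaving.closes Theorems.dssTruncationBridge_proof hW

/-- **Symmetry-erasing factorisation of the route**: `PolyhedralDssProfileExists → ¬ NavierStokesRegularity`
through `W₁`, i.e. WITHOUT using the polyhedral symmetry anywhere downstream of the crux.  This is the
formal content of "the bridge is G-blind": the polyhedral hypothesis is load-bearing only for the
EXISTENCE step itself. -/
theorem crux_decides_via_W₁ :
    QuantisedSymmetry.PolyhedralDssProfileExists → ¬ _root_.NavierStokesRegularity :=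
  fun hX => W₁_decides (crux_implies_W₁ hX)

/-- **W₂ is implied**: the crux negates the route's kill switch `PolyhedralTypeILiouville` (stmt-1405),
i.e. gives a nontrivial BOUNDED ancient mild G-equivariant Type-I solution (landed
`quantisedSymmetry_liouvilleKillsProfile_proof`, read contrapositively).  `¬ PolyhedralTypeILiouville` is
strictly weaker in form (no periodicity under the zoom) — and exactly for that reason no truncation
bridge `¬ PolyhedralTypeILiouville → ¬ NavierStokesRegularity` exists or is expected: a bounded ancient
solution is an OUTPUT of a Type-I blow-up (KNSS 2009 zoom), never an input that produces one. -/
theorem crux_implies_W₂ :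
    QuantisedSymmetry.PolyhedralDssProfileExists → ¬ QuantisedSymmetry.PolyhedralTypeILiouville :=
  fun hX hL => Theorems.quantisedSymmetry_liouvilleKillsProfile_proof hL hX

/-- **W₃ = the finite-lifespan statement** (conclusion of both truncation bridges; X5a of route `Blowup`). -/
def FiniteLifespanFromDecayingDatum : Prop :=
  ∃ ν : ℝ, 0 < ν ∧ ∃ T : ℝ, 0 < T ∧
    ∃ (u : ℝ → E3 → E3) (p : ℝ → E3 → ℝ),
      IsMaximalSmoothSolution ν 0 u p T ∧ IsLerayHopfOn T ν 0 (u 0) u ∧ HasRapidSpatialDecay (u 0)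

/-- `W₁ → W₃` is the proved G-blind bridge. -/
theorem W₁_implies_W₃ : Blowup.BlowupTypeIDssProfile → FiniteLifespanFromDecayingDatum :=
  fun hW => Theorems.dssTruncationBridge_proof hW

/-- `crux → W₃` is the route's own proved bridge `PolyhedralTruncationBridge` (stmt-11331). -/
theorem crux_implies_W₃ :
    QuantisedSymmetry.PolyhedralDssProfileExists → FiniteLifespanFromDecayingDatum := by
  rintro ⟨G, hfin, hdet, hirr, c, hc, u, hmild, hmeas, hdss, hdec, hequiv, hne⟩
  exact Theorems.quantisedSymmetry_polyhedralTruncationBridge_proof G hfin hdet hirr c hc u hmild hmeas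
    hdss hdec hequiv hne

/-! ## §D — the best typed split (approximation + compactness) -/

/-- An **approximate polyhedral cell** on the model period `[-1, -c⁻²] × ℝ³` with junction defect `ε`
and UNIFORM constants: sup bound `M`, Type-I spatial tail `C₀`, and a non-degeneracy floor `δ`
attained within radius `R` at the initial slice.  For `ε = 0` (and dropping the floor in favour of
`¬ v(-1) =ᵐ 0`) this is the cell of line `polyhedral_cell` (`PolyhedralCellExists`). -/
def IsApproxCell (G : Subgroup (E3 ≃ₗᵢ[ℝ] E3)) (c ε M C₀ δ R : ℝ) (v : ℝ → E3 → E3) : Prop :=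
  ContinuousOn (Function.uncurry v) (Set.Icc (-1 : ℝ) (-(c ^ 2)⁻¹) ×ˢ Set.univ) ∧
  (∀ t ∈ Set.Icc (-1 : ℝ) (-(c ^ 2)⁻¹), ∀ x, ‖v t x‖ ≤ M) ∧
  (∀ t ∈ Set.Icc (-1 : ℝ) (-(c ^ 2)⁻¹), ∀ x, ‖x‖ * ‖v t x‖ ≤ C₀) ∧
  (∀ t ∈ Set.Icc (-1 : ℝ) (-(c ^ 2)⁻¹), IsWeaklyDivFree (v t)) ∧
  (∀ s t : ℝ, -1 ≤ s → s < t → t ≤ -(c ^ 2)⁻¹ → ∀ x,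
      v t x = heatFlow (v s) (t - s) x - oseenDuhamel 1 s v v t x) ∧
  (∀ g ∈ G, ∀ t ∈ Set.Icc (-1 : ℝ) (-(c ^ 2)⁻¹), ∀ x, v t (g x) = g (v t x)) ∧
  (∀ x, ‖v (-(c ^ 2)⁻¹) x - c • v (-1) (c • x)‖ ≤ ε) ∧
  (∃ x, ‖x‖ ≤ R ∧ δ ≤ ‖v (-1) x‖)

/-- **D₁ (the open piece — carries ALL the existence content).**  For one polyhedral `G`, one factor
`c > 1` and FIXED constants `M, C₀, δ > 0, R`, approximate cells exist with arbitrarily small junction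
defect.  (`crux → D₁` holds via the landed profile-to-cell lemma `stub_cellOfProfile` with `ε = 0`; so,
modulo the provable `D₂`, `D₁ ↔ crux`: the uniform a-priori bounds ARE the existence problem.) -/
def UniformApproxCells : Prop :=
  ∃ G : Subgroup (E3 ≃ₗᵢ[ℝ] E3), IsPolyhedral G ∧ ∃ c M C₀ δ R : ℝ, 1 < c ∧ 0 < δ ∧
    ∀ ε > 0, ∃ v : ℝ → E3 → E3, IsApproxCell G c ε M C₀ δ R v

/-- **D₂ (the provable piece — parabolic compactness, size M/L).**  A family of approximate cells with
uniform constants and defect `ε → 0` has a locally uniformly convergent subsequence (interior parabolic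
regularity of bounded Oseen-mild fields; the datum `v(-1) = c⁻¹ v(-c⁻², ·/c) + O(ε)` inherits it); the
limit is an exact cell, non-trivial because the floor `δ` is attained in the FIXED ball `‖x‖ ≤ R`
(the Type-I tail `C₀` forbids escape to infinity), with `L⁴` datum from the tail and the sup bound;
the landed line `polyhedral_cell` (`PolyhedralDssProfileExists_of`, stubs 2a–2d landed) turns the cell
into the profile. -/
def ApproxCellCompactness : Prop :=
  ∀ G : Subgroup (E3 ≃ₗᵢ[ℝ] E3), IsPolyhedral G → ∀ c M C₀ δ R : ℝ, 1 < c → 0 < δ →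
    (∀ ε > 0, ∃ v : ℝ → E3 → E3, IsApproxCell G c ε M C₀ δ R v) →
      QuantisedSymmetry.PolyhedralDssProfileExists

/-- **Assembly of the split** (modus ponens; the triviality of the seam is irrelevant, the location of
the difficulty is the point: it sits entirely in `D₁`). -/
theorem crux_of_split (h₁ : UniformApproxCells) (h₂ : ApproxCellCompactness) :
    QuantisedSymmetry.PolyhedralDssProfileExists := by
  obtain ⟨G, hG, c, M, C₀, δ, R, hc, hδ, h⟩ := h₁
  exact h₂ G hG c M C₀ δ R hc hδ h

/-! ## §S — strengthenings -/

/-- **S₁: a SELF-SIMILAR (zoom-continuous) polyhedral Type-I profile** — the rigid strengthening. -/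
def SelfSimilarPolyhedralProfileExists : Prop :=
  ∃ G : Subgroup (E3 ≃ₗᵢ[ℝ] E3), IsPolyhedral G ∧ ∃ u : ℝ → E3 → E3,
    IsAncientMildSolution 1 u ∧ (∀ t < 0, AEStronglyMeasurable (u t) volume) ∧ IsSelfSimilar u ∧
    (∃ C₀ : ℝ, HasTypeIDecay C₀ u) ∧ (∀ g ∈ G, ∀ t x, u t (g x) = g (u t x)) ∧
    ¬ (∀ t < 0, u t =ᵐ[volume] 0)

/-- `S₁` would imply the crux (self-similar ⇒ `2`-DSS). -/
theorem selfSimilar_strengthening_implies_crux :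
    SelfSimilarPolyhedralProfileExists → QuantisedSymmetry.PolyhedralDssProfileExists := by
  rintro ⟨G, ⟨hfin, hdet, hirr⟩, u, hmild, hmeas, hss, hdec, hequiv, hne⟩
  exact ⟨G, hfin, hdet, hirr, 2, one_lt_two, u, hmild, hmeas, hss.isDiscretelySelfSimilar two_pos, hdec,
    hequiv, hne⟩

/-- **`S₁` is REFUTED in tree** (Tsai 1998 / Nečas–Růžička–Šverák 1996 at class level:
`ControlsClassLevel.typeI_ancient_selfSimilar_ae_zero`); the symmetry plays no role. -/
theorem not_selfSimilarPolyhedralProfileExists : ¬ SelfSimilarPolyhedralProfileExists := by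
  rintro ⟨G, -, u, hmild, hmeas, hss, ⟨C₀, hdec⟩, -, hne⟩
  exact hne (Theorems.ControlsClassLevel.typeI_ancient_selfSimilar_ae_zero hmild hmeas hdec hss)

/-- **S₂: the crux with a PRESCRIBED factor window** `c ∈ (1, 2]` (any profile is `cᵏ`-DSS for all
`k ≥ 1`, so prescribing an upper window is a genuine restriction only from below; Chae–Wolf Thm 1.3 /
tree N1 `stub_periodWindow` remove `c` close to `1` for a given Type-I constant).  Recorded as the
natural "rigid" target of a numerical continuation in `c`; it is not easier: the same a-priori bound is
missing. -/
def WindowedPolyhedralProfileExists : Prop :=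
  ∃ G : Subgroup (E3 ≃ₗᵢ[ℝ] E3), IsPolyhedral G ∧ ∃ c : ℝ, 1 < c ∧ c ≤ 2 ∧ ∃ u : ℝ → E3 → E3,
    IsAncientMildSolution 1 u ∧ (∀ t < 0, AEStronglyMeasurable (u t) volume) ∧
    IsDiscretelySelfSimilar c u ∧ (∃ C₀ : ℝ, HasTypeIDecay C₀ u) ∧
    (∀ g ∈ G, ∀ t x, u t (g x) = g (u t x)) ∧ ¬ (∀ t < 0, u t =ᵐ[volume] 0)

theorem windowed_strengthening_implies_crux :
    WindowedPolyhedralProfileExists → QuantisedSymmetry.PolyhedralDssProfileExists := by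
  rintro ⟨G, ⟨hfin, hdet, hirr⟩, c, hc, -, u, hmild, hmeas, hdss, hdec, hequiv, hne⟩
  exact ⟨G, hfin, hdet, hirr, c, hc, u, hmild, hmeas, hdss, hdec, hequiv, hne⟩

/-! ## §T — the sibling theorems the transfer attempts start from (names checked) -/

/-- Forward λ-DSS existence (Bradshaw–Tsai 2017 Thm 2.4 / Thm 1.2; Chae–Wolf 2017): the solved sibling. -/
example : bradshawTsai2017_thm_2_4 := bradshawTsai2017_thm_2_4_holds
example : chae_wolf_dss_existence := chae_wolf_dss_existence_holds

/-- Chae–Wolf 2017 Thm 1.1 (spatial Type-I decay of backward DSS profiles in `L^p_loc`, `p < 9`): the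
decay upgrade already absorbed by line `polyhedral_cell`. -/
example := @chaeWolf2017_dss_typeI_decay_of_lt_nine

end Summit.NavierStokesRegularity.NavierStokesRegularity.Cruxes.PolyhedralDssProfileExists.StrategistS19g9

end
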